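import Summits.CriticalPhenomena.SAWScalingLimit.Theorems.SAWTotalPositivityCriticalBubbleBoundJoinDefs
import Summits.CriticalPhenomena.SAWScalingLimit.Theorems.SAWTotalPositivityCriticalBubbleBoundDockingEntropyZero
import Literature.Probability.Percolation.LatticeSymmetry

/-!
# Transposing lex-rooted polygon classes
(line `docking-census-joining`, stub `lexRooted_transport_rot`)

Crux `stmt-CriticalPhenomena-7117`
(`Summit.CriticalPhenomena.SAWScalingLimit.Theses.SAWTotalPositivity.CriticalBubbleBound`), line
`docking-census-joining`, JOIN-MASS programme (lead c6), registered stub `lexRooted_transport_rot`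
(objects `lexRooted`, `width`, `height` of
`…Theorems.SAWTotalPositivityCriticalBubbleBoundJoinDefs`, `verts`, `pedges`, `rootEdge`, `shift`
of `…Theorems.SAWTotalPositivityCriticalBubbleBoundDockingDefs`).

**Statement.** For `n ≥ 3` there is a map `F` on vertex functions, injective on the lex-rooted
classes `lexRooted n`, mapping `lexRooted n` into itself and exchanging height and width:
`width (F χ) = height χ`, `height (F χ) = width χ`. This is one half of Hammond's Lemma 4.9
(`|SAP^right_n| ≥ p_n / 2`: the wide classes inject into the tall ones).

**Proof (transport of the translation class).** Transpose the rooted polygon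
`P(χ) = pedges n χ` by `(x₀, x₁) ↦ (x₁, x₀)` (the tree's lattice automorphism `transposeIso`)
after translating its LEFTMOST-THEN-LOWEST vertex `a` to the origin: the image `C` of `P(χ)`
under `g : x ↦ (x - a)ᵀ` is again a lattice polygon with `n + 1` edges
(`Docking.isPolygon_pedges_of_injOn`), and since the two polygon edges at `a` point east and
north (`exists_leftbottom_corner`, from `Docking.two_neighbours`), the vertical one `{a, a + e₁}`
is carried to the root edge `{0, e₀}`; opening `C` at the root edge
(`Docking.exists_sawFun_of_isPolygon`) gives `F χ ∈ sawFun 2 n e₀` with `pedges n (F χ) = C`.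
Its vertices are `g(verts χ)`, which are lexicographically `≥ 0` by the choice of `a` (so
`F χ ∈ lexRooted n`), and whose abscissae/ordinates are the translated ordinates/abscissae of
`verts χ` (so height and width are exchanged). Injectivity: equal images give
`P(χ₁) = P(χ₂) + w`; both being lex-rooted with lex-minimal vertex `0` forces `w = 0`, and a
self-avoiding walk is determined by its rooted polygon (`Docking.eq_of_pedges_shift_eq`).

Sources: A. Hammond, *An upper bound on the number of self-avoiding polygons via joining*, Ann.
Probab. 46 (2018), Lemma 4.9; N. Madras, G. Slade, *The Self-Avoiding Walk* (1993),
Def. 3.2.1–3.2.2. Elementary combinatorics ([folklore]).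
-/

noncomputable section

open Literature.Probability.LatticeModels
open Literature.Probability.RandomPlanarGeometry Literature.Probability.RandomPlanarGeometry.SAW
open scoped BigOperators
open Summit.CriticalPhenomena.SAWScalingLimit.Theorems.CriticalBubbleBound.Negative (e₀)
open Summit.CriticalPhenomena.SAWScalingLimit.Theorems.CriticalBubbleBound.Docking
open Literature.Probability.Percolation (transposeIso)

namespace Summit.CriticalPhenomena.SAWScalingLimit.Theorems.CriticalBubbleBound.Join

/-! ## The transposition of the axes -/

/-- The transposition `transposeIso : (x₀, x₁) ↦ (x₁, x₀)` of `ℤ²` fixes the origin. [folklore] -/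
theorem transpose_zero : transposeIso (0 : Site 2) = 0 := by
  ext i; fin_cases i <;> simp

/-- The transposition maps `e₁ = (0,1)` to `e₀ = (1,0)`. [folklore] -/
theorem transpose_e₁ : transposeIso e₁ = e₀ := by
  ext i; fin_cases i <;> simp [e₀_e₁_apply]

/-! ## Rooted polygons under maps of the plane -/

/-- Composing a vertex function with a map of the plane maps its vertex set. [folklore] -/
theorem verts_comp (f : Site 2 → Site 2) (n : ℕ) (ω : ℕ → Site 2) :
    verts n (fun i => f (ω i)) = (verts n ω).image f := by
  rw [Docking.verts, Docking.verts, Finset.image_image]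
  rfl

/-- Composing a vertex function with a map of the plane maps its rooted polygon edgewise.
[folklore] -/
theorem pedges_comp (f : Site 2 → Site 2) (n : ℕ) (ω : ℕ → Site 2) :
    pedges n (fun i => f (ω i)) = (pedges n ω).image (Sym2.map f) := by
  simp only [pedges, Finset.image_insert, Finset.image_image, Function.comp_def, Sym2.map_mk]

/-- Vertex functions with the same rooted polygon have the same vertices. [folklore] -/
theorem verts_eq_of_pedges_eq {n : ℕ} {η₁ η₂ : ℕ → Site 2}
    (h : pedges n η₁ = pedges n η₂) : verts n η₁ = verts n η₂ := by
  ext x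
  rw [← exists_mem_pedges_iff, ← exists_mem_pedges_iff, h]

/-- **Transport of a rooted polygon.** Let `ω ∈ sawFun 2 n e₀` (`n ≥ 2`) and let `g` be an
injective adjacency-preserving map of `ℤ²` carrying some edge `{a, b}` of `P(ω)` to the root
edge (`g a = 0`, `g b = e₀`). Then the image `g(P(ω))` is the rooted polygon of some
`χ ∈ sawFun 2 n e₀` (it is a polygon with `n + 1` edges through the root edge; open it there).
[cite: MadrasSlade1993, Definition 3.2.1] -/
theorem exists_sawFun_pedges_image {n : ℕ} {ω : ℕ → Site 2} (hω : ω ∈ Zd.sawFun 2 n e₀)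
    (hn : 2 ≤ n) {g : Site 2 → Site 2} (hg : Function.Injective g)
    (hga : ∀ x y, (zdGraph 2).Adj x y → (zdGraph 2).Adj (g x) (g y)) {a b : Site 2}
    (hab : s(a, b) ∈ pedges n ω) (ha : g a = 0) (hb : g b = e₀) :
    ∃ χ ∈ Zd.sawFun 2 n e₀, pedges n χ = (pedges n ω).image (Sym2.map g) := by
  obtain ⟨h0, hend, hadj, hinj⟩ := Zd.mem_sawFun.1 hω
  have hadj' : ∀ i < n, (zdGraph 2).Adj (g (ω i)) (g (ω (i + 1))) := fun i hi =>
    hga _ _ (hadj i hi)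
  have hinj' : Set.InjOn (fun i => g (ω i)) {i | i ≤ n} := fun i hi j hj hij =>
    hinj hi hj (hg hij)
  have hclose : (zdGraph 2).Adj (g (ω n)) (g (ω 0)) := by
    rw [hend n le_rfl, h0]
    exact hga _ _ Negative.adj_zero_e₀.symm
  obtain ⟨hP, hcard⟩ :=
    isPolygon_pedges_of_injOn (η := fun i => g (ω i)) hadj' hinj' hclose hn
  rw [pedges_comp] at hP hcard
  exact exists_sawFun_of_isPolygon hP
    (Finset.mem_image.2 ⟨_, hab, by rw [Sym2.map_mk, ha, hb, rootEdge]⟩) hcard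

/-! ## The leftmost-then-lowest corner -/

/-- A nonempty finite set of sites has a leftmost point that is lowest among the leftmost ones.
[folklore] -/
theorem exists_left_bottom {S : Finset (Site 2)} (hS : S.Nonempty) :
    ∃ a ∈ S, (∀ x ∈ S, a 0 ≤ x 0) ∧ ∀ x ∈ S, x 0 = a 0 → a 1 ≤ x 1 := by
  classical
  obtain ⟨t, ht, htmin⟩ := S.exists_min_image (fun x => x 0) hS
  obtain ⟨a, ha, hamin⟩ := (S.filter fun x => x 0 = t 0).exists_min_image (fun x => x 1)
    ⟨t, Finset.mem_filter.2 ⟨ht, rfl⟩⟩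
  rw [Finset.mem_filter] at ha
  refine ⟨a, ha.1, fun x hx => ?_, fun x hx hxa => hamin x (Finset.mem_filter.2 ⟨hx, ?_⟩)⟩
  · rw [ha.2]
    exact htmin x hx
  · rw [hxa, ha.2]

/-- **Left-bottom corner lemma.** The leftmost-then-lowest vertex `a` of the rooted polygon of
`ω ∈ sawFun 2 n e₀` (`n ≥ 2`): all vertices lie weakly right of `a`, those in its column
weakly above it, and the vertical edge `{a, a + e₁}` belongs to the polygon (the two
polygon-neighbours of `a` are distinct lattice-neighbours, and `a - e₀`, `a - e₁` are not
vertices). [folklore] -/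
theorem exists_leftbottom_corner {n : ℕ} {ω : ℕ → Site 2} (hω : ω ∈ Zd.sawFun 2 n e₀)
    (hn : 2 ≤ n) :
    ∃ a ∈ verts n ω, s(a, a + e₁) ∈ pedges n ω ∧ (∀ x ∈ verts n ω, a 0 ≤ x 0) ∧
      ∀ x ∈ verts n ω, x 0 = a 0 → a 1 ≤ x 1 := by
  obtain ⟨a, ha, hleft, hbot⟩ :=
    exists_left_bottom (S := verts n ω) ⟨ω 0, apply_mem_verts ω n.zero_le⟩
  refine ⟨a, ha, ?_, hleft, hbot⟩
  obtain ⟨m, hm, rfl⟩ := Finset.mem_image.1 ha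
  obtain ⟨p, hp, q, hq, hpq, hap, haq, hpe, hqe⟩ :=
    two_neighbours hω hn (Nat.lt_succ_iff.1 (Finset.mem_range.1 hm))
  have h₀ : ω m - e₀ ∉ verts n ω := fun h => by
    have h1 := hleft _ h
    simp only [Pi.sub_apply, e₀_e₁_apply.1] at h1
    omega
  have h₁ : ω m - e₁ ∉ verts n ω := fun h => by
    have h1 := hbot _ h (by simp [e₀_e₁_apply.2.2.1])
    simp only [Pi.sub_apply, e₀_e₁_apply.2.2.2] at h1
    omega
  rcases adj_cases hap with rfl | rfl | rfl | rfl <;>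
    rcases adj_cases haq with rfl | rfl | rfl | rfl <;>
    first
    | exact hpe
    | exact hqe
    | exact (h₀ hp).elim
    | exact (h₀ hq).elim
    | exact (h₁ hp).elim
    | exact (h₁ hq).elim
    | exact (hpq rfl).elim

/-! ## Corners of a transported polygon -/

/-- Maxima transport: if the vertices of `χ'` are the `g`-images of those of `χ` and coordinate
`k` of `g x` is coordinate `k'` of `x` minus `c`, then the maximal `k`-coordinate of `χ'` is the
maximal `k'`-coordinate of `χ` minus `c`. [folklore] -/
theorem max'_transport {n : ℕ} {χ χ' : ℕ → Site 2} {g : Site 2 → Site 2} {k k' : Fin 2}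
    {c : ℤ} (hg : ∀ x, g x k = x k' - c) (h : verts n χ' = (verts n χ).image g)
    (h₁ : ((Finset.range (n + 1)).image fun i => χ' i k).Nonempty)
    (h₂ : ((Finset.range (n + 1)).image fun i => χ i k').Nonempty) :
    ((Finset.range (n + 1)).image fun i => χ' i k).max' h₁ =
      ((Finset.range (n + 1)).image fun i => χ i k').max' h₂ - c := by
  apply le_antisymm
  · refine Finset.max'_le _ h₁ _ fun z hz => ?_
    obtain ⟨i, hi, rfl⟩ := Finset.mem_image.1 hz
    have hv : χ' i ∈ verts n χ' := Finset.mem_image_of_mem χ' hi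
    rw [h, Finset.mem_image] at hv
    obtain ⟨y, hy, hyx⟩ := hv
    obtain ⟨j, hj, rfl⟩ := Finset.mem_image.1 hy
    have hle := Finset.le_max' _ _ (Finset.mem_image_of_mem (fun i => χ i k') hj)
    rw [← hyx, hg]
    exact sub_le_sub_right hle c
  · obtain ⟨j, hj, hjm⟩ := Finset.mem_image.1 (Finset.max'_mem _ h₂)
    have hv : g (χ j) ∈ verts n χ' := by
      rw [h]
      exact Finset.mem_image_of_mem g
        (apply_mem_verts χ (Nat.lt_succ_iff.1 (Finset.mem_range.1 hj)))
    obtain ⟨i, hi, hig⟩ := Finset.mem_image.1 hv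
    calc ((Finset.range (n + 1)).image fun i => χ i k').max' h₂ - c = χ j k' - c := by rw [hjm]
      _ = g (χ j) k := (hg _).symm
      _ = χ' i k := by rw [hig]
      _ ≤ _ := Finset.le_max' _ _ (Finset.mem_image_of_mem (fun i => χ' i k) hi)

/-- Minima transport (same setting as `max'_transport`). [folklore] -/
theorem min'_transport {n : ℕ} {χ χ' : ℕ → Site 2} {g : Site 2 → Site 2} {k k' : Fin 2}
    {c : ℤ} (hg : ∀ x, g x k = x k' - c) (h : verts n χ' = (verts n χ).image g)
    (h₁ : ((Finset.range (n + 1)).image fun i => χ' i k).Nonempty)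
    (h₂ : ((Finset.range (n + 1)).image fun i => χ i k').Nonempty) :
    ((Finset.range (n + 1)).image fun i => χ' i k).min' h₁ =
      ((Finset.range (n + 1)).image fun i => χ i k').min' h₂ - c := by
  apply le_antisymm
  · obtain ⟨j, hj, hjm⟩ := Finset.mem_image.1 (Finset.min'_mem _ h₂)
    have hv : g (χ j) ∈ verts n χ' := by
      rw [h]
      exact Finset.mem_image_of_mem g
        (apply_mem_verts χ (Nat.lt_succ_iff.1 (Finset.mem_range.1 hj)))
    obtain ⟨i, hi, hig⟩ := Finset.mem_image.1 hv
    calc ((Finset.range (n + 1)).image fun i => χ' i k).min' h₁ ≤ χ' i k :=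
          Finset.min'_le _ _ (Finset.mem_image_of_mem (fun i => χ' i k) hi)
      _ = g (χ j) k := by rw [hig]
      _ = χ j k' - c := hg _
      _ = _ := by rw [hjm]
  · refine Finset.le_min' _ h₁ _ fun z hz => ?_
    obtain ⟨i, hi, rfl⟩ := Finset.mem_image.1 hz
    have hv : χ' i ∈ verts n χ' := Finset.mem_image_of_mem χ' hi
    rw [h, Finset.mem_image] at hv
    obtain ⟨y, hy, hyx⟩ := hv
    obtain ⟨j, hj, rfl⟩ := Finset.mem_image.1 hy
    have hle := Finset.min'_le _ _ (Finset.mem_image_of_mem (fun i => χ i k') hj)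
    rw [← hyx, hg]
    exact sub_le_sub_right hle c

/-! ## The transported class representative -/

/-- **The transposed class representative.** For `χ ∈ lexRooted n` (`n ≥ 3`) with
leftmost-then-lowest vertex `a`, the image of `P(χ)` under `g : x ↦ (x - a)ᵀ` is the rooted
polygon of a LEX-ROOTED `χ'` whose width is the height of `χ` and whose height is the width of
`χ`. [cite: Hammond2015SAPJoining, Lemma 4.9] -/
theorem transport_exists {n : ℕ} (hn : 3 ≤ n) {χ : ℕ → Site 2} (hχ : χ ∈ lexRooted n) :
    ∃ χ' : ℕ → Site 2, χ' ∈ lexRooted n ∧ width n χ' = height n χ ∧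
      height n χ' = width n χ ∧
      ∃ a : Site 2, pedges n χ' = (pedges n χ).image (Sym2.map fun x => transposeIso (x - a)) := by
  have hχs := lexRooted_subset n hχ
  have hn2 : 2 ≤ n := le_trans (by norm_num) hn
  obtain ⟨a, -, hae, hleft, hbot⟩ := exists_leftbottom_corner hχs hn2
  obtain ⟨χ', hχ', hpe⟩ := exists_sawFun_pedges_image hχs hn2 (g := fun x => transposeIso (x - a))
    (fun x y hxy => sub_left_injective (transposeIso.injective hxy))
    (fun x y hxy => transposeIso.map_adj_iff.2 ((Zd.zdGraph_adj_sub_right x y a).2 hxy)) hae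
    (by rw [sub_self, transpose_zero]) (by rw [add_sub_cancel_left, transpose_e₁])
  have hverts : verts n χ' = (verts n χ).image (fun x => transposeIso (x - a)) := by
    rw [verts_eq_of_pedges_eq (hpe.trans (pedges_comp _ n χ).symm)]
    exact verts_comp (fun x => transposeIso (x - a)) n χ
  have hg0 : ∀ x : Site 2, transposeIso (x - a) 0 = x 1 - a 1 := fun x => by simp
  have hg1 : ∀ x : Site 2, transposeIso (x - a) 1 = x 0 - a 0 := fun x => by simp
  have hxM : xmax n χ' = ymax n χ - a 1 :=
    max'_transport hg0 hverts (xs_nonempty n χ') (ys_nonempty n χ)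
  have hxm : xmin n χ' = ymin n χ - a 1 :=
    min'_transport hg0 hverts (xs_nonempty n χ') (ys_nonempty n χ)
  have hyM : ymax n χ' = xmax n χ - a 0 :=
    max'_transport hg1 hverts (ys_nonempty n χ') (xs_nonempty n χ)
  have hym : ymin n χ' = xmin n χ - a 0 :=
    min'_transport hg1 hverts (ys_nonempty n χ') (xs_nonempty n χ)
  refine ⟨χ', mem_lexRooted.2 ⟨hχ', fun m hm => ?_⟩, ?_, ?_, a, hpe⟩
  · have hv : χ' m ∈ verts n χ' := apply_mem_verts χ' hm
    rw [hverts, Finset.mem_image] at hv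
    obtain ⟨y, hy, hyx⟩ := hv
    have h2 := hbot y hy
    rw [← hyx, LexPos, hg0, hg1]
    rcases (hleft y hy).lt_or_eq with hlt | heq
    · exact Or.inl (by omega)
    · have h3 := h2 heq.symm
      exact Or.inr ⟨by omega, by omega⟩
  · rw [width, height, hxM, hxm]
    exact sub_sub_sub_cancel_right _ _ _
  · rw [height, width, hyM, hym]
    exact sub_sub_sub_cancel_right _ _ _

/-! ## Injectivity: un-transporting -/

/-- Un-transport: if the transported polygons of `χ₁` (by `a₁`) and `χ₂` (by `a₂`) coincide,
then `P(χ₁)` is the translate of `P(χ₂)` by `a₁ - a₂`. [folklore] -/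
theorem pedges_eq_pedges_shift {n : ℕ} {χ₁ χ₂ : ℕ → Site 2} {a₁ a₂ : Site 2}
    (h : (pedges n χ₁).image (Sym2.map fun x => transposeIso (x - a₁)) =
      (pedges n χ₂).image (Sym2.map fun x => transposeIso (x - a₂))) :
    pedges n χ₁ = pedges n (shift (a₁ - a₂) χ₂) := by
  have key : ∀ (χ : ℕ → Site 2) (b : Site 2),
      ((pedges n χ).image (Sym2.map fun x => transposeIso (x - b))).image
          (Sym2.map fun y => transposeIso y + a₁) = pedges n (fun i => χ i + (a₁ - b)) := by
    intro χ b
    rw [← pedges_comp, ← pedges_comp]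
    congr 1
    funext i
    ext j
    fin_cases j <;> simp <;> omega
  have h' := congrArg (fun E => E.image (Sym2.map fun y => transposeIso y + a₁)) h
  simp only [key, sub_self, add_zero] at h'
  exact h'

/-- A lattice vector that is lexicographically `≥ 0` together with its negative is `0`.
[folklore] -/
theorem eq_zero_of_lexPos_neg {w : Site 2} (h₁ : LexPos w) (h₂ : LexPos (-w)) : w = 0 := by
  unfold LexPos at h₁ h₂
  simp only [Pi.neg_apply] at h₂
  have hw1 : w 1 = 0 := by omega
  have hw0 : w 0 = 0 := by omega
  ext i; fin_cases i
  · exact hw0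
  · exact hw1

/-- **Injectivity of the transport.** Two lex-rooted `χ₁`, `χ₂` (`n ≥ 2`) whose transported
polygons coincide are equal: `P(χ₁) = P(χ₂) + w`, both have lex-minimal vertex `0`, so
`w = 0`, and a self-avoiding walk is determined by its rooted polygon. [folklore] -/
theorem eq_of_transport_eq {n : ℕ} (hn : 2 ≤ n) {χ₁ χ₂ : ℕ → Site 2}
    (h₁ : χ₁ ∈ lexRooted n) (h₂ : χ₂ ∈ lexRooted n) {a₁ a₂ : Site 2}
    (h : (pedges n χ₁).image (Sym2.map fun x => transposeIso (x - a₁)) =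
      (pedges n χ₂).image (Sym2.map fun x => transposeIso (x - a₂))) : χ₁ = χ₂ := by
  have hs₁ := lexRooted_subset n h₁
  have hs₂ := lexRooted_subset n h₂
  have key := pedges_eq_pedges_shift h
  have hv : verts n χ₁ = (verts n χ₂).image (fun x => x + (a₁ - a₂)) := by
    rw [verts_eq_of_pedges_eq key]
    exact verts_comp (fun x => x + (a₁ - a₂)) n χ₂
  have hz₁ : (0 : Site 2) ∈ verts n χ₁ := by
    rw [← (Zd.mem_sawFun.1 hs₁).1]; exact apply_mem_verts χ₁ n.zero_le
  have hz₂ : (0 : Site 2) ∈ verts n χ₂ := by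
    rw [← (Zd.mem_sawFun.1 hs₂).1]; exact apply_mem_verts χ₂ n.zero_le
  have hw₁ : LexPos (a₁ - a₂) := by
    have hw : (0 : Site 2) + (a₁ - a₂) ∈ verts n χ₁ := by
      rw [hv]; exact Finset.mem_image_of_mem _ hz₂
    rw [zero_add] at hw
    obtain ⟨m, hm, hmw⟩ := Finset.mem_image.1 hw
    rw [← hmw]
    exact (mem_lexRooted.1 h₁).2 m (Nat.lt_succ_iff.1 (Finset.mem_range.1 hm))
  have hw₂ : LexPos (-(a₁ - a₂)) := by
    rw [hv, Finset.mem_image] at hz₁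
    obtain ⟨y, hy, hy0⟩ := hz₁
    obtain ⟨m, hm, rfl⟩ := Finset.mem_image.1 hy
    rw [← eq_neg_of_add_eq_zero_left hy0]
    exact (mem_lexRooted.1 h₂).2 m (Nat.lt_succ_iff.1 (Finset.mem_range.1 hm))
  rw [eq_zero_of_lexPos_neg hw₁ hw₂, shift_by_zero] at key
  exact eq_of_pedges_shift_eq hs₁ hs₂ hn (v := 0) (by rwa [shift_by_zero, shift_by_zero])

/-! ## The stub -/

/-- **Stub `lexRooted_transport_rot` (half of Hammond's Lemma 4.9).** For `n ≥ 3` there is a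
map of vertex functions, injective on `lexRooted n`, sending every lex-rooted class
representative to a lex-rooted class representative with height and width exchanged
(transpose the polygon, translate its leftmost-then-lowest vertex to the origin, re-root at the
root edge). [cite: Hammond2015SAPJoining, Lemma 4.9] -/
theorem lexRooted_transport_rot : ∀ n : ℕ, 3 ≤ n → ∃ F : (ℕ → Site 2) → (ℕ → Site 2), Set.InjOn F ↑(lexRooted n) ∧ ∀ χ ∈ lexRooted n, F χ ∈ lexRooted n ∧ width n (F χ) = height n χ ∧ height n (F χ) = width n χ := by
  intro n hn
  classical
  have hn2 : 2 ≤ n := le_trans (by norm_num) hn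
  refine ⟨fun χ => if h : χ ∈ lexRooted n then Classical.choose (transport_exists hn h) else χ,
    ?_, ?_⟩
  · intro χ₁ h₁ χ₂ h₂ heq
    rw [Finset.mem_coe] at h₁ h₂
    simp only [dif_pos h₁, dif_pos h₂] at heq
    obtain ⟨-, -, -, a₁, ha₁⟩ := Classical.choose_spec (transport_exists hn h₁)
    obtain ⟨-, -, -, a₂, ha₂⟩ := Classical.choose_spec (transport_exists hn h₂)
    rw [heq] at ha₁
    exact eq_of_transport_eq hn2 h₁ h₂ (ha₁.symm.trans ha₂)
  · intro χ hχ
    simp only [dif_pos hχ]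
    obtain ⟨h1, h2, h3, -⟩ := Classical.choose_spec (transport_exists hn hχ)
    exact ⟨h1, h2, h3⟩

end Summit.CriticalPhenomena.SAWScalingLimit.Theorems.CriticalBubbleBound.Join

end
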